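import Mathlib
import Summits.Ventures.HodgeRepro2.T5NormCharConductor
import Summits.Ventures.HodgeRepro2.T6N5LocalRamCompletion

/-!
# A conjugate-symplectic character of odd conductor at EVERY ramified place (T5RamifiedOddConductor)

The datum condition `hodd` of t6-p8's `N5Local_main_ramified` (T6N5LocalRam: a conjugate-symplectic smooth character of
ODD conductor — the route's Lemma N5.L4 (iv-a), TIER5 §N5.12) was discharged on Mathlib's completions at TAME places
only (T6N5LocalRamCompletion.exists_CS_odd_level, hypothesis `IsUnit (2 : O_{K_v})`, conductor `1`); at WILD places it
stayed a parameter because the conductor of `η_v` at `p = 2` was not in the kernel.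

With T5NormCharConductor it is: put `f := normCharConductor v w σ ϖ hind ≥ 1` and `t := f − 1`. Then `η_v` is trivial on
`U_F^{(t+1)}` and some `y ∈ U_F^{(t)}` has `η_v(y) = −1`; the extension of `η_v` from `F_v^× U_E^{(2t+1)}` to `L_w^×`
(row 87, `exists_extension_trivial_on_higherUnits_odd_of_quadratic_ramified` at this `t`) is trivial on `U_E^{(2t+1)}`
and equals `−1` at `baseUnits y ∈ U_E^{(2t)}` (level doubling at a ramified place), so its conductor is EXACTLY
`2t + 1 = 2f − 1` — odd — at every ramified place, tame (`t = 0`) or wild, with no hypothesis on the residue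
characteristic. The shape is t6-p8's `exists_CS_odd_level` with `IsUnit 2` removed and the conductor value made explicit.
-/

namespace Summit.Ventures.HodgeRepro2.T5RamifiedOddConductor

open IsDedekindDomain HeightOneSpectrum
open Summit.Ventures.HodgeRepro2.T5ConductorArithmetic Summit.Ventures.HodgeRepro2.T5NormCharConductor
open Summit.Ventures.HodgeRepro2.T6.N5LocalInertCompletion Summit.Ventures.HodgeRepro2.T6.N5LocalRamCompletion

variable {K : Type*} [Field K] [NumberField K] (v : HeightOneSpectrum (NumberField.RingOfIntegers K))
  {L : Type*} [Field L] [NumberField L] [Algebra K L] (w : HeightOneSpectrum (NumberField.RingOfIntegers L))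
  [w.asIdeal.LiesOver v.asIdeal]
  [ContinuousSMul (v.adicCompletion K) (w.adicCompletion L)]
  [IsScalarTower K (v.adicCompletion K) (w.adicCompletion L)]

noncomputable section

omit [Algebra K L] [w.asIdeal.LiesOver v.asIdeal] [ContinuousSMul (v.adicCompletion K) (w.adicCompletion L)]
  [IsScalarTower K (v.adicCompletion K) (w.adicCompletion L)] in
/-- t6-p8's filtration `Uπ` of `L_w^×` IS `unitFiltration` (same definition, read at the place `w`). -/
theorem Uπ_eq_unitFiltration (π : w.adicCompletionIntegers L) (n : ℕ) : Uπ w π n = unitFiltration w π n :=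
  rfl

/-- THE DATUM CONDITION `hodd` AT EVERY RAMIFIED PLACE: a character `ω̃` of `L_w^×` that agrees with `η_v` (`ηF`) on
`F_v^×` — conjugate-symplectic — is smooth (trivial on `U_E^{(2t+1)}`) and has conductor EXACTLY `2t + 1` with
`t + 1 = normCharConductor v w σ ϖ hind` (the conductor exponent of `η_v`). No hypothesis on `2`. -/
theorem exists_CS_conductor_eq (h2 : Module.finrank (v.adicCompletion K) (w.adicCompletion L) = 2)
    {ϖ : v.adicCompletionIntegers K} (hϖ : Irreducible ϖ) {π : w.adicCompletionIntegers L} (hπ : Irreducible π)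
    (hram : ¬ Irreducible (algebraMap (v.adicCompletionIntegers K) (w.adicCompletionIntegers L) ϖ))
    (σ : (w.adicCompletion L) ≃ₐ[v.adicCompletion K] (w.adicCompletion L)) (hσ : σ ≠ 1)
    (hind : (T5AdicCompletionNormGroup.normGroup v w σ).index = 2) :
    ∃ ω : (w.adicCompletion L)ˣ →* ℂˣ, (∀ f : Fsub v w, ω f = ηF v w σ hind f) ∧
      (∃ m, Uπ w π m ≤ ω.ker) ∧
      conductor (Uπ w π) ω = 2 * (normCharConductor v w σ ϖ hind - 1) + 1 := by
  haveI : RootableBy ℂˣ ℤ := rootableByInt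
  have hf := one_le_normCharConductor v w σ h2 hσ hϖ hπ hram hind
  set t := normCharConductor v w σ ϖ hind - 1 with ht
  have htf : t + 1 = normCharConductor v w σ ϖ hind := by omega
  -- `η_v` is trivial on the level `t + 1 = f` of `K_v^×`
  have hη : ∀ (r : (v.adicCompletionIntegers K)ˣ)
      (h : intUnits w (T5PrincipalUnitComparison.unitsMap r) ∈ Fsub v w),
      r ∈ T5PrincipalUnitFiltration.higherUnits ϖ (t + 1) →
      ηF v w σ hind ⟨intUnits w (T5PrincipalUnitComparison.unitsMap r), h⟩ = 1 := by
    intro r h hr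
    set y : (v.adicCompletion K)ˣ :=
      Units.map (algebraMap (v.adicCompletionIntegers K) (v.adicCompletion K)).toMonoidHom r with hy
    have hfe : (⟨intUnits w (T5PrincipalUnitComparison.unitsMap r), h⟩ : Fsub v w) =
        ⟨T5UnramifiedCharacter.baseUnits v w y, ⟨y, rfl⟩⟩ := by
      apply Subtype.ext
      exact (baseUnits_map_eq v w r).symm
    rw [hfe, ηF_baseUnits]
    have hyk : y ∈ (T5LocalNormCharacter.normChar v w σ hind).ker := by
      apply unitFiltration_normCharConductor_le_ker v w σ hϖ hind
      rw [← htf]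
      exact ⟨r, hr, rfl⟩
    rw [MonoidHom.mem_ker] at hyk
    rw [hyk, map_one]
  obtain ⟨ω, hωF, hω1⟩ :=
    T5AdicCompletionRamified.exists_extension_trivial_on_higherUnits_odd_of_quadratic_ramified v w h2 hϖ hπ hram
      (Fsub v w) (fun s hs => exists_unitsMap_eq_of_mem_Fsub v w s hs) (ηF v w σ hind) t hη
  have hle : Uπ w π (2 * t + 1) ≤ ω.ker := by
    rintro x ⟨u', hu', rfl⟩
    exact MonoidHom.mem_ker.mpr (hω1 u' hu')
  -- non-trivial on level `2t`: the image of a `y ∈ U_F^{(t)}` with `η_v(y) = −1`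
  obtain ⟨y, hy, hyneg⟩ := exists_mem_unitFiltration_pred_normChar_eq_neg_one v w σ h2 hσ hϖ hπ hram hind
  have hnle : ¬ Uπ w π (2 * t) ≤ ω.ker := by
    intro h
    have hmem := h (baseUnits_mem_map_higherUnits_two_mul v w h2 hϖ hπ hram hy)
    rw [MonoidHom.mem_ker] at hmem
    have hval : ω (T5UnramifiedCharacter.baseUnits v w y) =
        Units.map (Int.castRingHom ℂ).toMonoidHom (-1 : ℤˣ) := by
      rw [← hyneg, ← ηF_baseUnits v w σ hind y]
      exact hωF ⟨T5UnramifiedCharacter.baseUnits v w y, ⟨y, rfl⟩⟩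
    rw [hval] at hmem
    have : ((Units.map (Int.castRingHom ℂ).toMonoidHom (-1 : ℤˣ) : ℂˣ) : ℂ) = 1 := by rw [hmem]; rfl
    simp at this
    norm_num at this
  refine ⟨ω, hωF, ⟨2 * t + 1, hle⟩, ?_⟩
  have hc1 : conductor (Uπ w π) ω ≤ 2 * t + 1 := conductor_le_of_le_ker hle
  have hc2 : ¬ conductor (Uπ w π) ω ≤ 2 * t := fun h =>
    hnle (le_ker_of_conductor_le (Uπ_antitone w π) ⟨2 * t + 1, hle⟩ h)
  omega

/-- `hodd` at every ramified place, in t6-p8's shape (`exists_CS_odd_level` without `IsUnit 2`): a conjugate-symplectic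
smooth character of ODD conductor. -/
theorem exists_CS_odd_level_of_ramified (h2 : Module.finrank (v.adicCompletion K) (w.adicCompletion L) = 2)
    {ϖ : v.adicCompletionIntegers K} (hϖ : Irreducible ϖ) {π : w.adicCompletionIntegers L} (hπ : Irreducible π)
    (hram : ¬ Irreducible (algebraMap (v.adicCompletionIntegers K) (w.adicCompletionIntegers L) ϖ))
    (σ : (w.adicCompletion L) ≃ₐ[v.adicCompletion K] (w.adicCompletion L)) (hσ : σ ≠ 1)
    (hind : (T5AdicCompletionNormGroup.normGroup v w σ).index = 2) :
    ∃ ω : (w.adicCompletion L)ˣ →* ℂˣ, (∀ f : Fsub v w, ω f = ηF v w σ hind f) ∧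
      (∃ m, Uπ w π m ≤ ω.ker) ∧ Odd (conductor (Uπ w π) ω) := by
  obtain ⟨ω, hωF, hm, hc⟩ := exists_CS_conductor_eq v w h2 hϖ hπ hram σ hσ hind
  exact ⟨ω, hωF, hm, hc ▸ odd_two_mul_add_one _⟩

/-- The same with `hind` supplied by row 167's uniform norm index theorem (`[L_w : K_v] = 2`, `σ ≠ 1` only):
at every ramified place there is a conjugate-symplectic smooth character of odd conductor. -/
theorem exists_CS_odd_level_of_ramified' (h2 : Module.finrank (v.adicCompletion K) (w.adicCompletion L) = 2)
    {ϖ : v.adicCompletionIntegers K} (hϖ : Irreducible ϖ) {π : w.adicCompletionIntegers L} (hπ : Irreducible π)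
    (hram : ¬ Irreducible (algebraMap (v.adicCompletionIntegers K) (w.adicCompletionIntegers L) ϖ))
    (σ : (w.adicCompletion L) ≃ₐ[v.adicCompletion K] (w.adicCompletion L)) (hσ : σ ≠ 1) :
    ∃ ω : (w.adicCompletion L)ˣ →* ℂˣ,
      (∀ f : Fsub v w, ω f = ηF v w σ (T5LocalNormIndex.index_normGroup_eq_two v w σ h2 hσ) f) ∧
      (∃ m, Uπ w π m ≤ ω.ker) ∧ Odd (conductor (Uπ w π) ω) :=
  exists_CS_odd_level_of_ramified v w h2 hϖ hπ hram σ hσ _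

end

end Summit.Ventures.HodgeRepro2.T5RamifiedOddConductor
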